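import Literature.Geometry.Symplectic.SteinPALF
import Literature.Topology.FourManifolds.BorderedEhresmann
import HarnessLib

/-!
# The product structure of a PALF over a box of regular values, horizontal boundary included

Topic `Literature/Geometry/Symplectic` (fact seat
`provefact-Literature.Geometry.Symplectic.Oba2016_s-add47373d4`; the `F × D²` part of Kas'
handlebody of a Lefschetz fibration over the disc — Kas 1980, Gompf–Stipsicz 1999 §8.2, quoted
by Oba 2016 §2.2 — in the tree's vocabulary `Literature.Geometry.Symplectic.PALF` of
`SteinPALF.lean`).  Everything is proved; no definitions, no named facts.

For a PALF `P : PALF o b` of the compact 4-manifold with boundary `W` (`f = P.f : W → ℝ² ⊇ 𝔻²`)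
and a box `K̂ = {u | |u i - c₀ i| ≤ Δ}` inside the OPEN unit disc containing no critical value,
the base values in `K̂` are regular for `f` (`P.submersion`) and for `f|∂W` (the horizontal
boundary is transverse to the fibres, `P.boundary_submersion`, read through the boundary datum
`b.incl : b.carrier ≅ ∂W`, whose differential lands in the boundary tangent hyperplane,
`Literature.Topology.FourManifolds.exists_apply_zero_eq_zero_and_mfderiv_eq`).  Ehresmann's theorem with boundary
(`Literature.Topology.FourManifolds.exists_trivialisation_of_box`, `BorderedEhresmann.lean`) then gives the **product
structure of `f` over the open box `Q = {u | |u i - c₀ i| < δ}`** (`δ ≤ Δ`):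
`PALF.exists_trivialisation_of_box` — smooth `Φ : ℝ² × W → W`, `Ψ : W → W` with
`f (Φ (u, y)) = u` and `Ψ (Φ (u, y)) = y` for `y` in the fibre `F = f⁻¹(c₀)` and `u ∈ Q`,
`f (Ψ x) = c₀` and `Φ (f x, Ψ x) = x` for `f x ∈ Q`, `Φ (c₀, ·) = id`, and `Φ`, `Ψ` preserve
`∂W` and `Int W` — so `Q × F → f⁻¹(Q)`, `(u, y) ↦ Φ (u, y)` is a bijection over `Q` with inverse
`x ↦ (f x, Ψ x)`, both smooth in the ambient sense, carrying `Q × (F ∩ ∂W)` onto the horizontal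
boundary `f⁻¹(Q) ∩ ∂W`.

## References

* A. Kas, *On the handlebody decomposition associated to a Lefschetz fibration*, Pacific J.
  Math. 89 (1980), 89–104, §1–§2. [Kas1980]
* R. E. Gompf, A. I. Stipsicz, *4-Manifolds and Kirby Calculus*, GSM 20 (1999), §8.2.
  [GompfStipsiczGSM1999]
* T. Oba, *Stein fillings of homology 3-spheres and mapping class groups*, Geom. Dedicata 183
  (2016); arXiv:1407.5257, §2.2 (p. 5). [Oba2016]
* Th. Bröcker, K. Jänich, *Introduction to Differential Topology*, CUP 1982, (8.12).
  [BrockerJanichIDT1982]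
-/

noncomputable section

open scoped Manifold ContDiff Topology
open Set Function

namespace Literature.Geometry.Symplectic

open Literature.Topology.FourManifolds

universe u

variable {W : Type u} [TopologicalSpace W] [ChartedSpace (EuclideanHalfSpace 4) W]
  [IsManifold (𝓡∂ 4) ∞ W]
  {o : SmoothOrientation (𝓡∂ 4) W} {b : BoundaryData (𝓡∂ 4) W (𝓡 3)} (P : PALF o b)

namespace PALF

/-- Over a box of the base inside the open unit disc and free of critical values, the
differential of the fibration map of a PALF is onto at every point. [folklore] -/
theorem surjective_mfderiv_of_box {c₀ : EuclideanSpace ℝ (Fin 2)} {Δ : ℝ}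
    (hcrit : ∀ p ∈ P.crit, ∃ i, Δ < |P.f p i - c₀ i|) {x : W} (hx : ∀ i, |P.f x i - c₀ i| ≤ Δ) :
    Surjective (mfderiv (𝓡∂ 4) 𝓘(ℝ, EuclideanSpace ℝ (Fin 2)) P.f x) := by
  refine P.submersion x fun hxc => ?_
  obtain ⟨i, hi⟩ := hcrit x hxc
  exact absurd (hx i) (not_le.2 hi)

/-- Over a box of the base inside the open unit disc, at a boundary point the differential of
the fibration map of a PALF is onto already on the boundary tangent hyperplane
`{v | v 0 = 0}`: the point is `b.incl y` with `‖f (b.incl y)‖ < 1`, `f ∘ b.incl` is a submersion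
at `y` (`P.boundary_submersion`), and `d(b.incl)` lands in the boundary tangent hyperplane.
[folklore] -/
theorem exists_tangent_preimage_of_box {c₀ : EuclideanSpace ℝ (Fin 2)} {Δ : ℝ}
    (hΔ : ∀ u : EuclideanSpace ℝ (Fin 2), (∀ i, |u i - c₀ i| ≤ Δ) → ‖u‖ < 1)
    {x : W} (hx : ∀ i, |P.f x i - c₀ i| ≤ Δ) (hxb : x ∈ (𝓡∂ 4).boundary W)
    (w : EuclideanSpace ℝ (Fin 2)) :
    ∃ v : EuclideanSpace ℝ (Fin 4), v 0 = 0 ∧ mfderiv (𝓡∂ 4) 𝓘(ℝ, EuclideanSpace ℝ (Fin 2)) P.f x v = w := by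
  have hxr : x ∈ range b.incl := by rw [b.range_incl]; exact hxb
  obtain ⟨y, rfl⟩ := hxr
  have h1 : ‖P.f (b.incl y)‖ < 1 := hΔ _ hx
  have hs := P.boundary_submersion y h1
  have hg : MDifferentiableAt (𝓡∂ 4) 𝓘(ℝ, EuclideanSpace ℝ (Fin 2)) P.f (b.incl y) :=
    P.contMDiff.mdifferentiableAt (by simp)
  have hfd : MDifferentiableAt (𝓡 3) (𝓡∂ 4) b.incl y :=
    b.isSmoothEmbedding.contMDiff.mdifferentiableAt (by simp)
  exact exists_apply_zero_eq_zero_and_mfderiv_eq (k := 3) b.incl_mem_boundary hg hfd hs w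

variable [T2Space W] [CompactSpace W]

/-- **The product structure of a PALF over a box of regular values, horizontal boundary
included** (Kas 1980 §1; Gompf–Stipsicz 1999 §8.2: *"`X₀ = F × D²` … a regular neighbourhood
of a regular fibre"*; here from Ehresmann's theorem with boundary,
`Literature.Topology.FourManifolds.exists_trivialisation_of_box`).  Let `P` be a PALF of the compact `W`, `c₀ ∈ ℝ²`,
`δ ≤ Δ`, such that the closed box
`K̂ = {u | ∀ i, |u i - c₀ i| ≤ Δ}` lies in the open unit disc and contains no critical value.
Then there are smooth `Φ : ℝ² × W → W` and `Ψ : W → W` such that, with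
`Q = {u | ∀ i, |u i - c₀ i| < δ}` and `F = f⁻¹(c₀)`: `Φ (c₀, y) = y`; for `y ∈ F` and `u ∈ Q`,
`f (Φ (u, y)) = u` and `Ψ (Φ (u, y)) = y`; for `f x ∈ Q`, `f (Ψ x) = c₀` and
`Φ (f x, Ψ x) = x`; `Φ (u, y) ∈ ∂W ↔ y ∈ ∂W` and `Ψ x ∈ ∂W ↔ x ∈ ∂W`.  In words:
`f⁻¹(Q) ≅ Q × F` over `Q`, by maps smooth in the ambient sense, the horizontal boundary
`f⁻¹(Q) ∩ ∂W` corresponding to `Q × ∂F`, `∂F = F ∩ ∂W`. [cite: Kas1980, §1]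
[cite: GompfStipsiczGSM1999, §8.2] [cite: BrockerJanichIDT1982, (8.12)] -/
theorem exists_trivialisation_of_box {c₀ : EuclideanSpace ℝ (Fin 2)} {δ Δ : ℝ} (hδΔ : δ ≤ Δ)
    (hΔ : ∀ u : EuclideanSpace ℝ (Fin 2), (∀ i, |u i - c₀ i| ≤ Δ) → ‖u‖ < 1)
    (hcrit : ∀ p ∈ P.crit, ∃ i, Δ < |P.f p i - c₀ i|) :
    ∃ (Φ : EuclideanSpace ℝ (Fin 2) × W → W) (Ψ : W → W),
      ContMDiff (𝓘(ℝ, EuclideanSpace ℝ (Fin 2)).prod (𝓡∂ 4)) (𝓡∂ 4) ∞ Φ ∧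
      ContMDiff (𝓡∂ 4) (𝓡∂ 4) ∞ Ψ ∧
      (∀ y, Φ (c₀, y) = y) ∧
      (∀ y, P.f y = c₀ → ∀ u : EuclideanSpace ℝ (Fin 2), (∀ i, |u i - c₀ i| < δ) →
        P.f (Φ (u, y)) = u ∧ Ψ (Φ (u, y)) = y) ∧
      (∀ x, (∀ i, |P.f x i - c₀ i| < δ) → P.f (Ψ x) = c₀ ∧ Φ (P.f x, Ψ x) = x) ∧
      (∀ u y, Φ (u, y) ∈ (𝓡∂ 4).boundary W ↔ y ∈ (𝓡∂ 4).boundary W) ∧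
      (∀ x, Ψ x ∈ (𝓡∂ 4).boundary W ↔ x ∈ (𝓡∂ 4).boundary W) :=
  Literature.Topology.FourManifolds.exists_trivialisation_of_box (k := 3) P.contMDiff hδΔ
    (fun _ hx _ => P.surjective_mfderiv_of_box hcrit hx)
    (fun _ hx hxb => P.exists_tangent_preimage_of_box hΔ hx hxb)

/-- The discs version of the hypotheses: if `‖c₀‖ + Δ √2 < 1` then the closed box of
half-width `Δ` about `c₀` lies in the open unit disc. [folklore] -/
theorem norm_lt_one_of_box {c₀ u : EuclideanSpace ℝ (Fin 2)} {Δ : ℝ} (hΔ0 : 0 ≤ Δ)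
    (h : ‖c₀‖ + Δ * Real.sqrt 2 < 1) (hu : ∀ i, |u i - c₀ i| ≤ Δ) : ‖u‖ < 1 := by
  have h1 : ‖u - c₀‖ ≤ Δ * Real.sqrt 2 := by
    rw [EuclideanSpace.norm_eq]
    have h2 : ∑ i, ‖(u - c₀) i‖ ^ 2 ≤ (Δ * Real.sqrt 2) ^ 2 := by
      rw [Fin.sum_univ_two, mul_pow, Real.sq_sqrt (by norm_num : (0 : ℝ) ≤ 2)]
      have ha := hu 0
      have hb := hu 1
      rw [PiLp.sub_apply, Real.norm_eq_abs, PiLp.sub_apply, Real.norm_eq_abs]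
      nlinarith [abs_nonneg (u 0 - c₀ 0), abs_nonneg (u 1 - c₀ 1), sq_abs (u 0 - c₀ 0),
        sq_abs (u 1 - c₀ 1)]
    calc Real.sqrt (∑ i, ‖(u - c₀) i‖ ^ 2) ≤ Real.sqrt ((Δ * Real.sqrt 2) ^ 2) :=
          Real.sqrt_le_sqrt h2
      _ = Δ * Real.sqrt 2 := Real.sqrt_sq (mul_nonneg hΔ0 (Real.sqrt_nonneg 2))
  calc ‖u‖ = ‖c₀ + (u - c₀)‖ := by rw [add_sub_cancel]
    _ ≤ ‖c₀‖ + ‖u - c₀‖ := norm_add_le _ _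
    _ ≤ ‖c₀‖ + Δ * Real.sqrt 2 := by linarith
    _ < 1 := h

end PALF

end Literature.Geometry.Symplectic

end
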